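import Mathlib
import Summits.Ventures.PercRepro2.Defs
import Summits.Ventures.PercRepro2.Independence
import Summits.Ventures.PercRepro2.Harris
import Summits.Ventures.PercRepro2.Graph
import Summits.Ventures.PercRepro2.Exploration
import Summits.Ventures.PercRepro2.Events
import Summits.Ventures.PercRepro2.Induced
import Summits.Ventures.PercRepro2.BoxUnionDefs
import Summits.Ventures.PercRepro2.BoxUnion
import Summits.Ventures.PercRepro2.BoxUnionPair
import Summits.Ventures.PercRepro2.BoxUnionPush
import Summits.Ventures.PercRepro2.BoxUnionPushSub
import Summits.Ventures.PercRepro2.PairTP2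
import Summits.Ventures.PercRepro2.PairTP2Main
import Summits.Ventures.PercRepro2.SeparatedDefs
import Summits.Ventures.PercRepro2.PairTP2Path

/-!
# The status law of the path `s – u – v – t` is not log-supermodular on any observed set
containing `u, v` — in particular the FULL two-cluster law is not
(blind cell PercRepro2, mine-1 g39; proofs/MINE1-ZLSM.md §3 (⟹ b) on the smallest instance)

Down-closure (`BoxUnionPair.pairLaw_lsm_of_subset`: log-supermodularity of the status law on `F`
passes to every `F' ⊆ F`) turns the sharpness instance of `PairTP2Path` into a statement about
every observed set `F ⊇ {u, v}` of the path `0 – 1 – 2 – 3`: at every interior weight vector the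
status law on `F` is NOT log-supermodular on the (Z)-lattice. With `F = univ` this is the
(⟹ b) direction of (Z-LSM) on its smallest instance: the middle edge `1 – 2` is LINKABLE
(`u ∈ C_s, v ∈ C_t` in the configuration `101`), and the full two-cluster law `(C_s, C_t)` on
`{s ↮ t}` is not log-supermodular — so the box-union mechanism (`hit_boxUnion_nonneg_univ`) is
unavailable on the path, for every interior weight vector.
-/

namespace Summit.Ventures.PercRepro2

namespace PairTP2Path

open Finset
open scoped Classical

/-- An interior weight vector is admissible. -/
lemma isProbVec_of_interior (p : Fin 3 → ℝ) (hp : ∀ e, 0 < p e ∧ p e < 1) : IsProbVec p :=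
  ⟨fun e => (hp e).1.le, fun e => (hp e).2.le⟩

/-- **No observed set containing `u, v` has a log-supermodular status law on the path**: for
`F ⊇ {1, 2}` and every interior weight vector, `pairLaw p pathEnds F 0 3` is not
log-supermodular on the (Z)-lattice (down-closure from `not_pairLaw_lsm`). -/
theorem not_pairLaw_lsm_of_subset (p : Fin 3 → ℝ) (hp : ∀ e, 0 < p e ∧ p e < 1)
    {F : Finset (Fin 4)} (hF : ({1, 2} : Finset (Fin 4)) ⊆ F) :
    ¬ ∀ x y : BoxUnionPair.ZLat (Fin 4),
      BoxUnionPair.pairLaw p pathEnds F 0 3 x * BoxUnionPair.pairLaw p pathEnds F 0 3 y ≤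
        BoxUnionPair.pairLaw p pathEnds F 0 3 (x ⊓ y) *
          BoxUnionPair.pairLaw p pathEnds F 0 3 (x ⊔ y) :=
  fun h => not_pairLaw_lsm p hp
    (fun x y => BoxUnionPair.pairLaw_lsm_of_subset pathEnds 0 3 (isProbVec_of_interior p hp) hF h x y)

/-- **The full two-cluster law of the path is not log-supermodular** at every interior weight
vector — (Z-LSM) (⟹ b) on the smallest instance: the middle edge is linkable. -/
theorem not_pairLaw_univ_lsm (p : Fin 3 → ℝ) (hp : ∀ e, 0 < p e ∧ p e < 1) :
    ¬ ∀ x y : BoxUnionPair.ZLat (Fin 4),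
      BoxUnionPair.pairLaw p pathEnds univ 0 3 x * BoxUnionPair.pairLaw p pathEnds univ 0 3 y ≤
        BoxUnionPair.pairLaw p pathEnds univ 0 3 (x ⊓ y) *
          BoxUnionPair.pairLaw p pathEnds univ 0 3 (x ⊔ y) :=
  not_pairLaw_lsm_of_subset p hp (Finset.subset_univ _)

end PairTP2Path

end Summit.Ventures.PercRepro2
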